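import Summits.BirchSwinnertonDyer.Rank1Residual.X11b.ClassClosureMinimalPair
import Summits.BirchSwinnertonDyer.Rank1Residual.X11b.ClassClosureRamCoefficient
import HarnessLib

/-!
# Class X11b = N8 (lane CLASS-CLOSURE, seat `cc-typer-3`): the Riemann-sum certificate in the
# currency of an instrument's SYMBOL TABLE — `x = u·ϖ·[·]⁺_f`, `‖u‖_p = 1`, `‖RS‖_p = 1`
# ⟹ `Iwasawa.RiemannSumUnitCertAt` ⟹ `Iwasawa.UnitCoeffAt` ⟹ the N8 minimal-pair roads
# (cell `b2b-bsdres`; composes p277881 with cc-eng-6's instantiation dictionary)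

HONEST FRAMING (verbatim, cell `b2b-bsdres`, run/shared/lean/b2b/bsd-rank1-residual/): the goal of
the cell is to DELETE the COMBINATION-SHAPED residual classes for ALL analytic-rank `≤ 1` curves
over `ℚ` — "full BSD formula for every rank `≤ 1` curve in class `C`" assembled STRICTLY from
published theorems — so that the rank-`≤ 1` remainder becomes exactly the CONSTRUCTION-SHAPED
classes, which are TYPED (missing-input Props), NOT attempted; this is not "finishing BSD".
Lane CLASS-CLOSURE: prove what is provable now; shrink each hard class to its core with data; no
claim beyond stated classes. THEOREMS ONLY (no definition, no named fact, no `sorry`); nothing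
booked; no label / mark changes; certificate rows are EVIDENCE / instrumentation.

## Why this file

The per-pair numerical input of the N8 roads is iw-1's `Iwasawa.RiemannSumUnitCertAt W p n`
(`Iwasawa/UnitCoefficientFromRiemannSum.lean`): for every newform `f` of `W` and every `ϖ` with
`ϖ·Ω_E = Ω⁺_f`, a bound `C` for the plus symbols `[a/p^m]⁺_f`, a level `n₀` and the exact Riemann
sums `RS` of the (signed) plus-symbol measure with the truncation inequality and `‖ϖ·RS k n₀‖_p = 1`
(`k = n` non-split, `k = n + 1` split). The ∀-newform quantifier was reduced to ONE newform in
`ClassClosureCertificateNewform` (p277881). cc-eng-6's instantiation dictionary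
(HOME/class-closure/eng-6/n8-mu/INSTANTIATION-NOTE.md, 2026-08-21) states what the lane's engines
actually tabulate: NOT `[r]⁺_f` and `ϖ` separately, but `E`'s OWN Néron-lattice-normalised
rational plus symbol `x_E(r)`, which equals `u · ϖ · [r]⁺_f` for every such `(f, ϖ)` with ONE
convention factor `u = ±2^j` (number of real components, the `½` in `plusSymbol`, orientation) —
a `p`-adic unit at odd `p`; the certificate they produce is `(C, n₀, RS^x)` for `x` with
`‖RS^x k n₀‖_p = 1` ("`ϖ` is inside the datum"). This file proves that this is enough, for ANY `ϖ`
(not assumed to be a `p`-adic unit): the truncation inequality is HOMOGENEOUS, so a certificate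
for the table `x = c·[·]⁺_f` (`c = u·ϖ ∈ ℚ_p^×`) is a certificate for `[·]⁺_f` with bound `C/‖c‖`
and `‖ϖ·RS k n₀‖ = ‖RS^x k n₀‖/‖u‖ = 1`.
* `finsum_sum_const_mul`, `exists_riemannSumCert_of_eq_mul` — the abstract scaling step;
* `riemannSumUnitCertAt_of_symbolTable` — `Iwasawa.RiemannSumUnitCertAt W p n` from ONE newform
  `f₀`, its period ratio `ϖ₀`, a unit `u` and a table `x` with `x r = u·ϖ₀·[r]⁺_{f₀}` certified
  in its own currency; `unitCoeffAt_of_symbolTable` (hence `MuAnZeroAt` by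
  `muAnZeroAt_of_unitCoeffAt`); `norm_ratCast_mul_two_pow_eq_one` (`u = ±2^j` is a unit, `p` odd);
* class level: `bsdp_of_symbolTable_one` (¬(ram) minimal pairs, p276240's
  `bsdp_of_unitCoeffAt_one`: X11b, `p ≥ 5`, `ρ̄` onto) and `bsdp_of_ram_of_symbolTable_one`
  ((ram) minimal pairs, p282302's `bsdp_of_ram_of_unitCoeffAt_one`).
The ONE hypothesis that is not a finite computation is isolated BY NAME: `hx`, the identification
of the instrument's symbol with `u·ϖ₀·[·]⁺_{f₀}` (cc-eng-6 §1: carried by the two-engine +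
`check_T` discipline on the instrument side). The bound `∀ m a, ‖x(a/p^m)‖ ≤ C` is over ALL levels,
as in iw-1's shape. Nothing about any curve is asserted; nothing booked; X11b stays
CONSTRUCTION-SHAPED; which rows instantiate `hx`/`hns`/`hs` is the census seats' EVIDENCE.

References: [MazurTateTeitelbaum1986Invent] §I.8, §I.10 Prop., §I.13–I.14; [SteinWuthrich2013] §3,
§4.2; [AtkinLehner1970] Thm. 4; [Wuthrich2014] Thm. 3, Cor. 19; [Skinner2016PacificMC] Thm. A;
[Disegni2020] Thm. 1; HOME/class-closure/O2/TYPER-3.md §14; HOME/class-closure/eng-6/n8-mu/.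
-/

set_option autoImplicit false

noncomputable section

open scoped Classical MatrixGroups ModularForm

open CongruenceSubgroup WeierstrassCurve Literature.NumberTheory.EllipticCurves
  Literature.NumberTheory.EllipticCurves.ModularForms
  Literature.NumberTheory.EllipticCurves.Rank1Residual
  Literature.NumberTheory.EllipticCurves.Rank1Residual.Typed
  Literature.NumberTheory.EllipticCurves.Skinner2016
  Literature.NumberTheory.EllipticCurves.SteinWuthrich2013
  Literature.NumberTheory.EllipticCurves.Wuthrich2014
  Literature.NumberTheory.EllipticCurves.Disegni2020

namespace Summit.BirchSwinnertonDyer.Rank1Residual.X11b.ClassClosure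

open X11a

/-! ### §1 The scaling step (abstract: any distribution, any scalar) -/

section Scaling

variable {p : ℕ} [Fact p.Prime]

/-- A constant comes out of the (finite) double Riemann sum over Teichmüller classes and
`s mod p^m`. [folklore] -/
theorem finsum_sum_const_mul {m : ℕ} (c : ℚ_[p])
    (F : rootsOfUnity (torsionOrder p) ℤ_[p] → ZMod (p ^ m) → ℚ_[p]) :
    (∑ᶠ ξ : rootsOfUnity (torsionOrder p) ℤ_[p], ∑ s : ZMod (p ^ m), c * F ξ s) =
      c * ∑ᶠ ξ : rootsOfUnity (torsionOrder p) ℤ_[p], ∑ s : ZMod (p ^ m), F ξ s := by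
  haveI := neZero_torsionOrder p
  haveI := Fintype.ofFinite (rootsOfUnity (torsionOrder p) ℤ_[p])
  simp only [finsum_eq_sum_of_fintype, Finset.mul_sum]

/-- **Homogeneity of the Riemann-sum certificate.** Let `ψ = c·φ` and `ψ₀ = c·φ₀` be distributions
scaled by one constant `c ∈ ℚ_p` (`ψ`: the summand table, `ψ₀`: the table the bound is stated
for — they differ by the sign `(−1)^m` at a non-split prime). If the Riemann sums `RS` of `ψ`
carry a certificate at `(k, n₀)` — bound `‖ψ₀‖ ≤ C`, truncation inequality
`(C/‖k!‖_p)·p^{−n₀} < ‖RS k n₀‖`, and `‖RS k n₀‖ = 1` — then the Riemann sums `RS'` of `φ` carry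
the certificate with bound `C/‖c‖`, the same `n₀`, and `‖ϖ·RS' k n₀‖ = 1` for every `ϖ` with
`‖ϖ‖ = ‖c‖` (`c ≠ 0` because `‖RS k n₀‖ = 1`). [cite: MazurTateTeitelbaum1986Invent, §I.13 (shape)]
[cite: SteinWuthrich2013, §3 (Riemann sums / precision)] -/
theorem exists_riemannSumCert_of_eq_mul
    {φ ψ φ₀ ψ₀ : (m : ℕ) → ZMod (p ^ m) → ℚ_[p]} {c : ℚ_[p]}
    (hψ : ∀ (m : ℕ) (a : ZMod (p ^ m)), ψ m a = c * φ m a)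
    (hψ₀ : ∀ (m : ℕ) (a : ZMod (p ^ m)), ψ₀ m a = c * φ₀ m a)
    {RS : ℕ → ℕ → ℚ_[p]}
    (hRS : ∀ k m : ℕ, RS k m =
      ∑ᶠ ξ : rootsOfUnity (torsionOrder p) ℤ_[p], ∑ s : ZMod (p ^ m),
        ψ (m + cyclotomicExponent p)
            (PadicInt.toZModPow (m + cyclotomicExponent p) ((ξ : ℤ_[p]ˣ) : ℤ_[p]) *
              (cyclotomicGenerator p : ZMod (p ^ (m + cyclotomicExponent p))) ^ s.val) *
          ((s.val.choose k : ℕ) : ℚ_[p]))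
    {C : ℝ} (hC : ∀ (m : ℕ) (a : ZMod (p ^ m)), ‖ψ₀ m a‖ ≤ C) {k n₀ : ℕ}
    (hlt : C / ‖((k.factorial : ℕ) : ℚ_[p])‖ * (p : ℝ) ^ (-n₀ : ℤ) < ‖RS k n₀‖)
    (hunit : ‖RS k n₀‖ = 1) {ϖ : ℚ_[p]} (hϖ : ‖ϖ‖ = ‖c‖) :
    ∃ (C' : ℝ) (n₀' : ℕ) (RS' : ℕ → ℕ → ℚ_[p]),
      (∀ k m : ℕ, RS' k m =
        ∑ᶠ ξ : rootsOfUnity (torsionOrder p) ℤ_[p], ∑ s : ZMod (p ^ m),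
          φ (m + cyclotomicExponent p)
              (PadicInt.toZModPow (m + cyclotomicExponent p) ((ξ : ℤ_[p]ˣ) : ℤ_[p]) *
                (cyclotomicGenerator p : ZMod (p ^ (m + cyclotomicExponent p))) ^ s.val) *
            ((s.val.choose k : ℕ) : ℚ_[p])) ∧
      (∀ (m : ℕ) (a : ZMod (p ^ m)), ‖φ₀ m a‖ ≤ C') ∧
      C' / ‖((k.factorial : ℕ) : ℚ_[p])‖ * (p : ℝ) ^ (-n₀' : ℤ) < ‖RS' k n₀'‖ ∧
      ‖ϖ * RS' k n₀'‖ = 1 := by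
  obtain ⟨RS', hRS'⟩ : ∃ RS' : ℕ → ℕ → ℚ_[p], ∀ k m : ℕ, RS' k m =
      ∑ᶠ ξ : rootsOfUnity (torsionOrder p) ℤ_[p], ∑ s : ZMod (p ^ m),
        φ (m + cyclotomicExponent p)
            (PadicInt.toZModPow (m + cyclotomicExponent p) ((ξ : ℤ_[p]ˣ) : ℤ_[p]) *
              (cyclotomicGenerator p : ZMod (p ^ (m + cyclotomicExponent p))) ^ s.val) *
          ((s.val.choose k : ℕ) : ℚ_[p]) := ⟨_, fun _ _ ↦ rfl⟩
  have hscale : ∀ k m : ℕ, RS k m = c * RS' k m := by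
    intro k m
    haveI := neZero_torsionOrder p
    haveI := Fintype.ofFinite (rootsOfUnity (torsionOrder p) ℤ_[p])
    rw [hRS, hRS']
    simp only [finsum_eq_sum_of_fintype, Finset.mul_sum, hψ, mul_assoc]
  have hc : c ≠ 0 := by
    rintro rfl
    rw [hscale, zero_mul, norm_zero] at hunit
    exact zero_ne_one hunit
  have hc' : 0 < ‖c‖ := norm_pos_iff.mpr hc
  refine ⟨C / ‖c‖, n₀, RS', hRS', fun m a ↦ ?_, ?_, ?_⟩
  · rw [le_div_iff₀ hc']
    calc ‖φ₀ m a‖ * ‖c‖ = ‖ψ₀ m a‖ := by rw [hψ₀, norm_mul, mul_comm]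
      _ ≤ C := hC m a
  · have hre : C / ‖c‖ / ‖((k.factorial : ℕ) : ℚ_[p])‖ * (p : ℝ) ^ (-n₀ : ℤ) =
        C / ‖((k.factorial : ℕ) : ℚ_[p])‖ * (p : ℝ) ^ (-n₀ : ℤ) / ‖c‖ := by ring
    rw [hre, div_lt_iff₀ hc', mul_comm (‖RS' k n₀‖)]
    have h := hlt
    rwa [hscale, norm_mul] at h
  · rw [norm_mul, hϖ, ← norm_mul, ← hscale, hunit]

/-- The convention factor of cc-eng-6's dictionary, `u = ±2^j` (`j ≥ 0`), is a `p`-adic unit at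
every odd prime `p`. [folklore] -/
theorem norm_ratCast_mul_two_pow_eq_one (hp : p ≠ 2) {σ : ℤ} (hσ : σ = 1 ∨ σ = -1) (j : ℕ) :
    ‖(((σ : ℚ) * 2 ^ j : ℚ) : ℚ_[p])‖ = 1 := by
  have h2 : ‖(2 : ℚ_[p])‖ = 1 := by
    have h := (Padic.norm_natCast_eq_one_iff (p := p) (n := 2)).mpr
      ((Nat.coprime_primes (Fact.out : p.Prime) Nat.prime_two).mpr hp)
    rw [Nat.cast_ofNat] at h
    exact h
  have hσ' : ‖(σ : ℚ_[p])‖ = 1 := by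
    rcases hσ with rfl | rfl <;> simp
  push_cast
  rw [norm_mul, norm_pow, hσ', h2, one_pow, mul_one]

end Scaling

/-! ### §2 `Iwasawa.RiemannSumUnitCertAt` / `UnitCoeffAt` from a certified symbol table -/

section SymbolTable

variable (W : WeierstrassCurve ℚ) [W.IsElliptic] (p : ℕ) [Fact p.Prime]

/-- **The Riemann-sum unit certificate from a certified SYMBOL TABLE** (cc-eng-6's native currency).
Data: ONE newform `f₀` of `W` with period ratio `ϖ₀` (`ϖ₀·Ω_E = Ω⁺_{f₀}`), a rational `u` with
`‖u‖_p = 1`, and a table `x : ℚ → ℚ` IDENTIFIED with `u·ϖ₀·[·]⁺_{f₀}` (`hx` — the one hypothesis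
that is not a finite computation). Certificate, in `x`'s own currency: a bound `‖x(a/p^m)‖_p ≤ C`
(all levels), a level `n₀`, the exact Riemann sums `RS` of the `x`-measure (signed `(−1)^m` at a
non-split `p`) with `(C/‖k!‖_p)·p^{−n₀} < ‖RS k n₀‖` and `‖RS k n₀‖_p = 1` at `k = n` (non-split)
resp. `k = n + 1` (split). Conclusion: `Iwasawa.RiemannSumUnitCertAt W p n` — for EVERY newform and
EVERY period ratio (p277881) and for THIS `ϖ₀` whatever its `p`-adic valuation (homogeneity,
`exists_riemannSumCert_of_eq_mul`). Nothing about any curve is asserted; nothing booked.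
[cite: MazurTateTeitelbaum1986Invent, §I.8, §I.10 Prop. and §I.13–I.14 (shape)]
[cite: SteinWuthrich2013, §3 and §4.2] [cite: AtkinLehner1970, Thm. 4] -/
theorem riemannSumUnitCertAt_of_symbolTable {N₀ : ℕ} [NeZero N₀] {f₀ : CuspForm (Gamma0 N₀) 2}
    (hf₀ : IsNewformOf W f₀) {ϖ₀ : ℚ} (hϖ₀ : (ϖ₀ : ℝ) * W.realPeriodRat = plusPeriod f₀)
    {u : ℚ} (hu : ‖((u : ℚ) : ℚ_[p])‖ = 1) {x : ℚ → ℚ}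
    (hx : ∀ r : ℚ, x r = u * ϖ₀ * ratPlusSymbol f₀ r) {n : ℕ}
    (hns : ¬ W.HasSplitMultiplicativeReductionAtPrime p →
        ∃ (C : ℝ) (n₀ : ℕ) (RS : ℕ → ℕ → ℚ_[p]),
          (∀ k m : ℕ, RS k m =
            ∑ᶠ ξ : rootsOfUnity (torsionOrder p) ℤ_[p], ∑ s : ZMod (p ^ m),
              (fun (m : ℕ) (a : ZMod (p ^ m)) ↦
                  (-1 : ℚ_[p]) ^ m * (x ((a.val : ℚ) / (p : ℚ) ^ m) : ℚ_[p]))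
                (m + cyclotomicExponent p)
                  (PadicInt.toZModPow (m + cyclotomicExponent p) ((ξ : ℤ_[p]ˣ) : ℤ_[p]) *
                    (cyclotomicGenerator p : ZMod (p ^ (m + cyclotomicExponent p))) ^ s.val) *
                ((s.val.choose k : ℕ) : ℚ_[p])) ∧
          (∀ (m : ℕ) (a : ZMod (p ^ m)), ‖(x ((a.val : ℚ) / (p : ℚ) ^ m) : ℚ_[p])‖ ≤ C) ∧
          C / ‖((n.factorial : ℕ) : ℚ_[p])‖ * (p : ℝ) ^ (-n₀ : ℤ) < ‖RS n n₀‖ ∧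
          ‖RS n n₀‖ = 1)
    (hs : W.HasSplitMultiplicativeReductionAtPrime p →
        ∃ (C : ℝ) (n₀ : ℕ) (RS : ℕ → ℕ → ℚ_[p]),
          (∀ k m : ℕ, RS k m =
            ∑ᶠ ξ : rootsOfUnity (torsionOrder p) ℤ_[p], ∑ s : ZMod (p ^ m),
              (fun (m : ℕ) (a : ZMod (p ^ m)) ↦ (x ((a.val : ℚ) / (p : ℚ) ^ m) : ℚ_[p]))
                (m + cyclotomicExponent p)
                  (PadicInt.toZModPow (m + cyclotomicExponent p) ((ξ : ℤ_[p]ˣ) : ℤ_[p]) *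
                    (cyclotomicGenerator p : ZMod (p ^ (m + cyclotomicExponent p))) ^ s.val) *
                ((s.val.choose k : ℕ) : ℚ_[p])) ∧
          (∀ (m : ℕ) (a : ZMod (p ^ m)), ‖(x ((a.val : ℚ) / (p : ℚ) ^ m) : ℚ_[p])‖ ≤ C) ∧
          C / ‖(((n + 1).factorial : ℕ) : ℚ_[p])‖ * (p : ℝ) ^ (-n₀ : ℤ) < ‖RS (n + 1) n₀‖ ∧
          ‖RS (n + 1) n₀‖ = 1) :
    Iwasawa.RiemannSumUnitCertAt W p n := by
  obtain ⟨c, hc⟩ : ∃ c : ℚ_[p], c = ((u : ℚ) : ℚ_[p]) * ((ϖ₀ : ℚ) : ℚ_[p]) := ⟨_, rfl⟩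
  have hϖc : ‖((ϖ₀ : ℚ) : ℚ_[p])‖ = ‖c‖ := by rw [hc, norm_mul, hu, one_mul]
  have hx' : ∀ (m : ℕ) (a : ZMod (p ^ m)),
      (x ((a.val : ℚ) / (p : ℚ) ^ m) : ℚ_[p]) =
        c * (ratPlusSymbol f₀ ((a.val : ℚ) / (p : ℚ) ^ m) : ℚ_[p]) := by
    intro m a
    rw [hx, Rat.cast_mul, Rat.cast_mul, hc]
  have hxs : ∀ (m : ℕ) (a : ZMod (p ^ m)),
      (-1 : ℚ_[p]) ^ m * (x ((a.val : ℚ) / (p : ℚ) ^ m) : ℚ_[p]) =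
        c * ((-1 : ℚ_[p]) ^ m * (ratPlusSymbol f₀ ((a.val : ℚ) / (p : ℚ) ^ m) : ℚ_[p])) := by
    intro m a
    rw [hx' m a]
    ring
  refine @riemannSumUnitCertAt_of_newform W _ p _ N₀ _ f₀ hf₀ ϖ₀ hϖ₀ n ?_ ?_
  · intro h
    obtain ⟨C, n₀, RS, hRS, hC, hlt, hunit⟩ := hns h
    exact exists_riemannSumCert_of_eq_mul
      (φ := fun (m : ℕ) (a : ZMod (p ^ m)) ↦
        (-1 : ℚ_[p]) ^ m * (ratPlusSymbol f₀ ((a.val : ℚ) / (p : ℚ) ^ m) : ℚ_[p]))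
      (ψ := fun (m : ℕ) (a : ZMod (p ^ m)) ↦
        (-1 : ℚ_[p]) ^ m * (x ((a.val : ℚ) / (p : ℚ) ^ m) : ℚ_[p]))
      (φ₀ := fun (m : ℕ) (a : ZMod (p ^ m)) ↦ (ratPlusSymbol f₀ ((a.val : ℚ) / (p : ℚ) ^ m) : ℚ_[p]))
      (ψ₀ := fun (m : ℕ) (a : ZMod (p ^ m)) ↦ (x ((a.val : ℚ) / (p : ℚ) ^ m) : ℚ_[p]))
      hxs hx' hRS hC hlt hunit hϖc
  · intro h
    obtain ⟨C, n₀, RS, hRS, hC, hlt, hunit⟩ := hs h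
    exact exists_riemannSumCert_of_eq_mul
      (φ := fun (m : ℕ) (a : ZMod (p ^ m)) ↦ (ratPlusSymbol f₀ ((a.val : ℚ) / (p : ℚ) ^ m) : ℚ_[p]))
      (ψ := fun (m : ℕ) (a : ZMod (p ^ m)) ↦ (x ((a.val : ℚ) / (p : ℚ) ^ m) : ℚ_[p]))
      (φ₀ := fun (m : ℕ) (a : ZMod (p ^ m)) ↦ (ratPlusSymbol f₀ ((a.val : ℚ) / (p : ℚ) ^ m) : ℚ_[p]))
      (ψ₀ := fun (m : ℕ) (a : ZMod (p ^ m)) ↦ (x ((a.val : ℚ) / (p : ℚ) ^ m) : ℚ_[p]))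
      hx' hx' hRS hC hlt hunit hϖc

/-- **`Iwasawa.UnitCoeffAt W p n` from a certified symbol table** at a multiplicative prime
(`riemannSumUnitCertAt_of_symbolTable` ∘ iw-1's `unitCoeffAt_of_riemannSumUnitCertAt`); hence also
x11a's `MuAnZeroAt W p` by `muAnZeroAt_of_unitCoeffAt`. Nothing booked.
[cite: SteinWuthrich2013, §3, §4.2 and §11 remark (p. 29)] [cite: GreenbergVatsal2000, p. 2–3, (1)–(2)] -/
theorem unitCoeffAt_of_symbolTable (hmult : W.HasMultiplicativeReductionAtPrime p)
    {N₀ : ℕ} [NeZero N₀] {f₀ : CuspForm (Gamma0 N₀) 2}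
    (hf₀ : IsNewformOf W f₀) {ϖ₀ : ℚ} (hϖ₀ : (ϖ₀ : ℝ) * W.realPeriodRat = plusPeriod f₀)
    {u : ℚ} (hu : ‖((u : ℚ) : ℚ_[p])‖ = 1) {x : ℚ → ℚ}
    (hx : ∀ r : ℚ, x r = u * ϖ₀ * ratPlusSymbol f₀ r) {n : ℕ}
    (hns : ¬ W.HasSplitMultiplicativeReductionAtPrime p →
        ∃ (C : ℝ) (n₀ : ℕ) (RS : ℕ → ℕ → ℚ_[p]),
          (∀ k m : ℕ, RS k m =
            ∑ᶠ ξ : rootsOfUnity (torsionOrder p) ℤ_[p], ∑ s : ZMod (p ^ m),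
              (fun (m : ℕ) (a : ZMod (p ^ m)) ↦
                  (-1 : ℚ_[p]) ^ m * (x ((a.val : ℚ) / (p : ℚ) ^ m) : ℚ_[p]))
                (m + cyclotomicExponent p)
                  (PadicInt.toZModPow (m + cyclotomicExponent p) ((ξ : ℤ_[p]ˣ) : ℤ_[p]) *
                    (cyclotomicGenerator p : ZMod (p ^ (m + cyclotomicExponent p))) ^ s.val) *
                ((s.val.choose k : ℕ) : ℚ_[p])) ∧
          (∀ (m : ℕ) (a : ZMod (p ^ m)), ‖(x ((a.val : ℚ) / (p : ℚ) ^ m) : ℚ_[p])‖ ≤ C) ∧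
          C / ‖((n.factorial : ℕ) : ℚ_[p])‖ * (p : ℝ) ^ (-n₀ : ℤ) < ‖RS n n₀‖ ∧
          ‖RS n n₀‖ = 1)
    (hs : W.HasSplitMultiplicativeReductionAtPrime p →
        ∃ (C : ℝ) (n₀ : ℕ) (RS : ℕ → ℕ → ℚ_[p]),
          (∀ k m : ℕ, RS k m =
            ∑ᶠ ξ : rootsOfUnity (torsionOrder p) ℤ_[p], ∑ s : ZMod (p ^ m),
              (fun (m : ℕ) (a : ZMod (p ^ m)) ↦ (x ((a.val : ℚ) / (p : ℚ) ^ m) : ℚ_[p]))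
                (m + cyclotomicExponent p)
                  (PadicInt.toZModPow (m + cyclotomicExponent p) ((ξ : ℤ_[p]ˣ) : ℤ_[p]) *
                    (cyclotomicGenerator p : ZMod (p ^ (m + cyclotomicExponent p))) ^ s.val) *
                ((s.val.choose k : ℕ) : ℚ_[p])) ∧
          (∀ (m : ℕ) (a : ZMod (p ^ m)), ‖(x ((a.val : ℚ) / (p : ℚ) ^ m) : ℚ_[p])‖ ≤ C) ∧
          C / ‖(((n + 1).factorial : ℕ) : ℚ_[p])‖ * (p : ℝ) ^ (-n₀ : ℤ) < ‖RS (n + 1) n₀‖ ∧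
          ‖RS (n + 1) n₀‖ = 1) :
    Iwasawa.UnitCoeffAt W p n :=
  Iwasawa.unitCoeffAt_of_riemannSumUnitCertAt hmult
    (riemannSumUnitCertAt_of_symbolTable W p hf₀ hϖ₀ hu hx hns hs)

end SymbolTable

/-! ### §3 Class level: the N8 minimal-pair roads fed by a certified symbol table -/

section ClassLevel

variable (W : WeierstrassCurve ℚ) [W.IsElliptic] [W.IsGloballyMinimal] (p : ℕ) [Fact p.Prime]

/-- **¬(ram) MINIMAL PAIR from a symbol table** (= p276240's `bsdp_of_unitCoeffAt_one` ∘
`unitCoeffAt_of_symbolTable` at index `1`): on X11b at `p ≥ 5` with `ρ̄_{E,p}` onto, ONE certified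
symbol table — `‖RS 1 n₀‖_p = 1` non-split, `‖RS 2 n₀‖_p = 1` split — gives `BSD(E,p)` from the
named facts Kato–Wuthrich A32, Stein–Wuthrich Thm 6.1 ×2 + §4.2 ×2, Disegni 2020 Thm 1, GZK,
modularity (+ at a split `p`: a second multiplicative prime or the EVIDENCE-labelled conjecture
`RelativeExceptionalLeadingTermAt W p`), modulo `hx`. CONDITIONAL; nothing booked; X11b stays
CONSTRUCTION-SHAPED. [cite: Wuthrich2014, Thm. 3 (p. 382) and Cor. 19 proof (p. 399)]
[cite: SteinWuthrich2013, Thm. 6.1 (p. 20), §4.2, §11 remark (p. 29)] [cite: Disegni2020, Thm. 1 (§1.2), hypothesis (∗)]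
[cite: MazurTateTeitelbaum1986Invent, §I.10 Prop. and §I.13–I.14] -/
theorem bsdp_of_symbolTable_one
    (hKato : kato_charIdeal_dvd_multiplicative_of_surjective)
    (hJn : thm61_nonsplitMultiplicative) (hJs : thm61_splitMultiplicative)
    (hHn : exists_isMultCanonical) (hHs : exists_isSplitMultCanonical)
    (hD : thm1_padicBSD_rankOne_multiplicative)
    (hGZK : rank_eq_analyticRank_of_analyticRank_le_one) (hpar : nonempty_modularParametrizationData)
    (hX : ClassX11b W p) (hp : 5 ≤ p) (hsurj : Surj W p)
    {N₀ : ℕ} [NeZero N₀] {f₀ : CuspForm (Gamma0 N₀) 2}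
    (hf₀ : IsNewformOf W f₀) {ϖ₀ : ℚ} (hϖ₀ : (ϖ₀ : ℝ) * W.realPeriodRat = plusPeriod f₀)
    {u : ℚ} (hu : ‖((u : ℚ) : ℚ_[p])‖ = 1) {x : ℚ → ℚ}
    (hx : ∀ r : ℚ, x r = u * ϖ₀ * ratPlusSymbol f₀ r)
    (hns : ¬ W.HasSplitMultiplicativeReductionAtPrime p →
        ∃ (C : ℝ) (n₀ : ℕ) (RS : ℕ → ℕ → ℚ_[p]),
          (∀ k m : ℕ, RS k m =
            ∑ᶠ ξ : rootsOfUnity (torsionOrder p) ℤ_[p], ∑ s : ZMod (p ^ m),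
              (fun (m : ℕ) (a : ZMod (p ^ m)) ↦
                  (-1 : ℚ_[p]) ^ m * (x ((a.val : ℚ) / (p : ℚ) ^ m) : ℚ_[p]))
                (m + cyclotomicExponent p)
                  (PadicInt.toZModPow (m + cyclotomicExponent p) ((ξ : ℤ_[p]ˣ) : ℤ_[p]) *
                    (cyclotomicGenerator p : ZMod (p ^ (m + cyclotomicExponent p))) ^ s.val) *
                ((s.val.choose k : ℕ) : ℚ_[p])) ∧
          (∀ (m : ℕ) (a : ZMod (p ^ m)), ‖(x ((a.val : ℚ) / (p : ℚ) ^ m) : ℚ_[p])‖ ≤ C) ∧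
          C / ‖(((1 : ℕ).factorial : ℕ) : ℚ_[p])‖ * (p : ℝ) ^ (-n₀ : ℤ) < ‖RS 1 n₀‖ ∧
          ‖RS 1 n₀‖ = 1)
    (hs : W.HasSplitMultiplicativeReductionAtPrime p →
        ∃ (C : ℝ) (n₀ : ℕ) (RS : ℕ → ℕ → ℚ_[p]),
          (∀ k m : ℕ, RS k m =
            ∑ᶠ ξ : rootsOfUnity (torsionOrder p) ℤ_[p], ∑ s : ZMod (p ^ m),
              (fun (m : ℕ) (a : ZMod (p ^ m)) ↦ (x ((a.val : ℚ) / (p : ℚ) ^ m) : ℚ_[p]))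
                (m + cyclotomicExponent p)
                  (PadicInt.toZModPow (m + cyclotomicExponent p) ((ξ : ℤ_[p]ˣ) : ℤ_[p]) *
                    (cyclotomicGenerator p : ZMod (p ^ (m + cyclotomicExponent p))) ^ s.val) *
                ((s.val.choose k : ℕ) : ℚ_[p])) ∧
          (∀ (m : ℕ) (a : ZMod (p ^ m)), ‖(x ((a.val : ℚ) / (p : ℚ) ^ m) : ℚ_[p])‖ ≤ C) ∧
          C / ‖(((1 + 1 : ℕ).factorial : ℕ) : ℚ_[p])‖ * (p : ℝ) ^ (-n₀ : ℤ) < ‖RS (1 + 1) n₀‖ ∧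
          ‖RS (1 + 1) n₀‖ = 1)
    (hγ : W.HasSplitMultiplicativeReductionAtPrime p →
      (∃ (m : ℕ) (_ : Fact m.Prime), m ≠ p ∧ W.HasMultiplicativeReductionAtPrime m) ∨
        RelativeExceptionalLeadingTermAt W p) :
    BSDp W p :=
  bsdp_of_unitCoeffAt_one W p hKato hJn hJs hHn hHs hD hGZK hpar hX hp hsurj
    (unitCoeffAt_of_symbolTable W p hX.2.2.1 hf₀ hϖ₀ hu hx hns hs) hγ

/-- **(ram) MINIMAL PAIR from a symbol table** (= p282302's `bsdp_of_ram_of_unitCoeffAt_one` ∘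
`unitCoeffAt_of_symbolTable` at index `1`): on the (ram) atom of X11b — non-split at ANY odd `p`,
split at `p ≥ 5` — ONE certified symbol table gives `BSD(E,p)` from Skinner 2016 Thm A,
Stein–Wuthrich Thm 6.1 ×2 + §4.2 ×2, Disegni 2020 Thm 1, GZK, modularity, modulo `hx`. No image
hypothesis beyond `ClassX11b`'s irreducibility, no regulator row, no `μ`. CONDITIONAL; nothing
booked; readings at `p = 3` are the x11b3 team's, not this seat's.
[cite: Skinner2016PacificMC, Thm. A] [cite: SteinWuthrich2013, Thm. 6.1 (p. 20), §4.2]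
[cite: Disegni2020, Thm. 1 (§1.2), hypothesis (∗)] [cite: MazurTateTeitelbaum1986Invent, §I.10 Prop. and §I.13–I.14] -/
theorem bsdp_of_ram_of_symbolTable_one (hA : thmA_charIdeal_multiplicative)
    (hJn : thm61_nonsplitMultiplicative) (hJs : thm61_splitMultiplicative)
    (hHn : exists_isMultCanonical) (hHs : exists_isSplitMultCanonical)
    (hD : thm1_padicBSD_rankOne_multiplicative)
    (hGZK : rank_eq_analyticRank_of_analyticRank_le_one) (hpar : nonempty_modularParametrizationData)
    (hX : ClassX11b W p) (hram : Ram W p)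
    (hp5 : W.HasSplitMultiplicativeReductionAtPrime p → 5 ≤ p)
    {N₀ : ℕ} [NeZero N₀] {f₀ : CuspForm (Gamma0 N₀) 2}
    (hf₀ : IsNewformOf W f₀) {ϖ₀ : ℚ} (hϖ₀ : (ϖ₀ : ℝ) * W.realPeriodRat = plusPeriod f₀)
    {u : ℚ} (hu : ‖((u : ℚ) : ℚ_[p])‖ = 1) {x : ℚ → ℚ}
    (hx : ∀ r : ℚ, x r = u * ϖ₀ * ratPlusSymbol f₀ r)
    (hns : ¬ W.HasSplitMultiplicativeReductionAtPrime p →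
        ∃ (C : ℝ) (n₀ : ℕ) (RS : ℕ → ℕ → ℚ_[p]),
          (∀ k m : ℕ, RS k m =
            ∑ᶠ ξ : rootsOfUnity (torsionOrder p) ℤ_[p], ∑ s : ZMod (p ^ m),
              (fun (m : ℕ) (a : ZMod (p ^ m)) ↦
                  (-1 : ℚ_[p]) ^ m * (x ((a.val : ℚ) / (p : ℚ) ^ m) : ℚ_[p]))
                (m + cyclotomicExponent p)
                  (PadicInt.toZModPow (m + cyclotomicExponent p) ((ξ : ℤ_[p]ˣ) : ℤ_[p]) *
                    (cyclotomicGenerator p : ZMod (p ^ (m + cyclotomicExponent p))) ^ s.val) *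
                ((s.val.choose k : ℕ) : ℚ_[p])) ∧
          (∀ (m : ℕ) (a : ZMod (p ^ m)), ‖(x ((a.val : ℚ) / (p : ℚ) ^ m) : ℚ_[p])‖ ≤ C) ∧
          C / ‖(((1 : ℕ).factorial : ℕ) : ℚ_[p])‖ * (p : ℝ) ^ (-n₀ : ℤ) < ‖RS 1 n₀‖ ∧
          ‖RS 1 n₀‖ = 1)
    (hs : W.HasSplitMultiplicativeReductionAtPrime p →
        ∃ (C : ℝ) (n₀ : ℕ) (RS : ℕ → ℕ → ℚ_[p]),
          (∀ k m : ℕ, RS k m =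
            ∑ᶠ ξ : rootsOfUnity (torsionOrder p) ℤ_[p], ∑ s : ZMod (p ^ m),
              (fun (m : ℕ) (a : ZMod (p ^ m)) ↦ (x ((a.val : ℚ) / (p : ℚ) ^ m) : ℚ_[p]))
                (m + cyclotomicExponent p)
                  (PadicInt.toZModPow (m + cyclotomicExponent p) ((ξ : ℤ_[p]ˣ) : ℤ_[p]) *
                    (cyclotomicGenerator p : ZMod (p ^ (m + cyclotomicExponent p))) ^ s.val) *
                ((s.val.choose k : ℕ) : ℚ_[p])) ∧
          (∀ (m : ℕ) (a : ZMod (p ^ m)), ‖(x ((a.val : ℚ) / (p : ℚ) ^ m) : ℚ_[p])‖ ≤ C) ∧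
          C / ‖(((1 + 1 : ℕ).factorial : ℕ) : ℚ_[p])‖ * (p : ℝ) ^ (-n₀ : ℤ) < ‖RS (1 + 1) n₀‖ ∧
          ‖RS (1 + 1) n₀‖ = 1) :
    BSDp W p :=
  bsdp_of_ram_of_unitCoeffAt_one W p hA hJn hJs hHn hHs hD hGZK hpar hX hram hp5
    (unitCoeffAt_of_symbolTable W p hX.2.2.1 hf₀ hϖ₀ hu hx hns hs)

end ClassLevel

end Summit.BirchSwinnertonDyer.Rank1Residual.X11b.ClassClosure

end
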